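import Summits.QuantumFields.BalabanUV.T4Continuum.Support.NE7CurvedSupLetterDiv
import Summits.QuantumFields.BalabanUV.T4Continuum.Support.NE3CovLiftCurl
import Summits.QuantumFields.BalabanUV.T4Continuum.Support.NE3QbarIterCovLift
import HarnessLib

/-!
# NE7CurvedSupLetterData — THE THREE FLAT DATA OF THE CUT-OFF GAUGED SLICE ELEMENT `Z = χ•Y^u` IN THE COMB GAUGE FROM A FAR CORNER, UNIFORMLY: near-flatness of `W^u` on the whole working
# region (`comb_near_flat`, `ball_near_flat`), the curl datum (`curl_datum`), the divergence datum (`div_datum_uniform`), the straight datum (`straight_datum_uniform`), and the support of `Z` in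
# the flat cube (`support_of_cutoff`) — the inputs of `NE7FlatSupLetterCompact.sup_flat_compact` in the bootstrap for THE CURVED SUP LETTER (L) (memo ROAD-G100 §4; assembled in `NE7CurvedSupLetter`)

Cell `pub-balaban`, rung (B)+1 sub-cell t4, lineage `b2b-balaban-t4-ne7-p1`, generation 101 (CRUX PROVER NE7 #1 = OWNER of BINDER row NE7).  Memo `t4/b2b-balaban-t4-ne7-p1-g101/ROAD-G101.md` §6.
GEOMETRY.  `M = L^{k+1}`, `b₀ = blk_M y₀`, corner `cb = b₀ − C₃·𝟙` with `C₃ = K_b + nbRad + 3`, gauge `u = btree M W cb`: every site `w` with `|w_i − (y₀)_i| ≤ M·K_b + t`, `t ≤ M·nbRad + 2M + 1`, lies in the forward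
cone of `M•cb` at `ℓ¹`-distance `≤ (d+1)·2M·C₃`, so `‖W^u(w,ν) − 1‖ ≤ (d+1)·2MC₃·x =: δ` (`NE3QbarIterCovLift.norm_comb_sub_one_le_l1`); this covers the plaquettes of the cut-off (`t = 2`), the divergence
stars (`t = 0`), and the fine balls `|x′ − M•bc|₁ ≤ nbRad·Σ_{i≤k}L^i` of every block `bc` with `|M bc − y₀|_∞ ≤ MK_b + 2M` (`t = M·nbRad + 2M`).
WHAT ([folklore]; 0 def, 0 sorry; dimension `d + 1`, `L ≥ 2`, multi-level small-field class at `W`).  §1 `comb_near_flat`, `abs_apply_le_l1`, `ball_near_flat`.  §2 **`curl_datum`**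
(`‖curl₁(χ•Y^u)‖ ≤ B + 16δS + 2g₁S`: `NE7CutoffLeibniz.norm_curlAt_smul_fun_sub_le` + `NE3CovLiftCurl.norm_curlAt_sub_flat_le` + `curlAt_gaugeAct`).  §3 **`div_datum_uniform`** (`NE7CurvedSupLetterDiv.div_datum`
with `|χ| ≤ 1`).  §4 **`straight_datum_uniform`** (`NE7CurvedSupLetterPrep.straight_datum_closed ∕ _off_support`, case split on whether `χ` vanishes on the straight-average region).  §5 **`support_of_cutoff`**
(`chi 0 (MK_b) y₀` vanishes off `box (MK_b) y₀ ⊂` the `4M`-interior of the cube `M•(b₀ − (K_b+6)𝟙) + [0, M(2K_b+12))^{d+1}`).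
HONEST FRAMING (page 1): bookkeeping BY NAME; nothing of Bałaban's asserted; THE CURVED LETTER (L) IS NOT PROVED HERE (its data only); NOT (S1), NOT NE7; spine 0∕9; finite T⁴ rung (B)+1 — NOT
infinite volume, NOT mass gap, NOT BetaPertH, NOT Clay.  Continuum YM on T⁴ ⇐ BetaPertH ∧ nine spine estimates (0/9 proved); BetaPertH ⇐ (D1) ∧ (D4) ∧ CAP+tail; G-an2-4 gates asym, D1 and NE2/3/4.
-/

set_option autoImplicit false

open scoped BigOperators Matrix.Norms.L2Operator
open Finset

namespace Summit.QuantumFields.BalabanUV.T4Continuum.NE7CurvedSupLetterData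

open Literature.MathematicalPhysics.QuantumFieldTheory.Balaban1983to89
open B7Prop1Explicit B7Prop2Explicit
open T4AveragingDeficitWall (IsUnitaryCfg IsSkewDir SmallField Ad curlAt box)
open AveragingDeficitCounting (mem_box_iff self_mem_box)
open AveragingDeficitTransport (norm_Ad_of_unitary)
open AveragingDeficitMultiLevelPrep (LevelSmall)
open AveragingDeficitTwoLevelPrep (prop1Radius)
open AveragingDeficitLocality (dirGauge)
open AveragingDeficitBlockDensity (btree btree_mem)
open AveragingDeficitLatticeH2Prep (chi chi_eq_zero_of_not_mem)
open SpreadLift (loopRad)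
open BlockAverageVaryHolo (nbRad)
open BlockAveragePushDirSplit (flat)
open NE3CoercivityScaling (flatDiv)
open NE3CovariantWeitzenbock (covDiv)
open NE3CovariantLineSumsError (Csup)
open NE3TangentCovariantTower (QbarIter)
open NE3FramePotBound (isUnitaryCfg_flat)
open NE3CovLiftCurl (curlAt_gaugeAct norm_curlAt_sub_flat_le)
open NE3QbarIterCovLift (norm_comb_sub_one_le_l1)
open NE3QbarIterCovLiftPrep (sum_pow_le_pow)
open SpreadLiftDirection (isUnitaryCfg_gaugeAct')
open SmoothRefineBlocks (blk res blk_add_res res_nonneg res_le)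
open NE7MeanZeroGaugeSupPoincare (l1_le_of_box)
open NE7NestedCovariantExtension (nestedExt)
open NE7CutoffLeibniz (norm_curlAt_smul_fun_sub_le)
open NE7LocalStraightDatumLetter (norm_dirGauge_le)
open NE7CurvedSupLetterPrep (straight_datum_closed straight_datum_off_support)
open NE7CurvedSupLetterDiv (div_datum)

noncomputable section

variable {d : ℕ} {n : Type*} [Fintype n] [DecidableEq n]

/-! ## §1 Near-flatness of the comb gauge on the working region -/

/-- **THE COMB GAUGE FROM THE FAR CORNER IS NEAR-FLAT ON THE WORKING REGION** (`M = L^{k+1} ≥ 1`, unitary `W` with `SmallField W x`, `x ≥ 0`; `C₃ = K_b + nb + 3`): for every `w` with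
`|w_i − (y₀)_i| ≤ M·K_b + t` (all `i`) and `t ≤ M·nb + 2M + 1`: `‖W^u(w,ν) − 1‖ ≤ (d+1)·(2MC₃)·x`, `u = btree M W (blk_M y₀ − C₃·𝟙)`. [folklore] -/
theorem comb_near_flat [Nonempty n] {M : ℕ} (hM1 : 1 ≤ M) {W : Site (d + 1) → Fin (d + 1) → (Matrix n n ℂ)ˣ} {x : ℝ} (hWu : IsUnitaryCfg W) (hx : 0 ≤ x) (hWx : SmallField W x)
    (y₀ : Site (d + 1)) (Kb nb C₃ : ℕ) (hC₃ : C₃ = Kb + nb + 3) (w : Site (d + 1)) (t : ℤ)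
    (hw : ∀ i, |w i - y₀ i| ≤ (M : ℤ) * Kb + t) (ht : t ≤ (M : ℤ) * nb + 2 * (M : ℤ) + 1) (ν : Fin (d + 1)) :
    ‖((gaugeAct (btree M W (fun i => blk M y₀ i - (C₃ : ℤ))) W w ν : (Matrix n n ℂ)ˣ) : Matrix n n ℂ) - 1‖
      ≤ (((d + 1 : ℕ) : ℝ) * ((((2 * (M * C₃) + 1 : ℕ) : ℝ)) - 1)) * x := by
  have hMz1 : (1 : ℤ) ≤ (M : ℤ) := by exact_mod_cast hM1
  -- `y₀` against its block corner
  have hy₀b : ∀ i, 0 ≤ y₀ i - (M : ℤ) * blk M y₀ i ∧ y₀ i - (M : ℤ) * blk M y₀ i ≤ (M : ℤ) - 1 := by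
    intro i
    have h := congr_fun (blk_add_res M y₀) i
    simp only [Pi.add_apply, Pi.smul_apply, smul_eq_mul] at h
    have h0 := res_nonneg hM1 y₀ i
    have h1 := res_le hM1 y₀ i
    constructor <;> linarith only [h, h0, h1]
  have hreg : ∀ i, |w i - (M : ℤ) * blk M y₀ i| ≤ ((M * C₃ : ℕ) : ℤ) := by
    intro i
    have h1 := abs_le.mp (hw i)
    obtain ⟨h2, h3⟩ := hy₀b i
    have e : ((M * C₃ : ℕ) : ℤ) = (M : ℤ) * Kb + (M : ℤ) * nb + 3 * (M : ℤ) := by rw [hC₃]; push_cast; ring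
    rw [e, abs_le]
    constructor <;> linarith only [h1.1, h1.2, h2, h3, ht, hMz1]
  have hcbw : (M : ℤ) • (fun i => blk M y₀ i - (C₃ : ℤ)) ≤ w := fun i => by
    have := (abs_le.mp (hreg i)).1
    simp only [Pi.smul_apply, smul_eq_mul]
    push_cast at this ⊢
    nlinarith only [this]
  refine (norm_comb_sub_one_le_l1 hWu hx hWx _ hcbw ν).trans (mul_le_mul_of_nonneg_right ?_ hx)
  refine l1_le_of_box (M := 2 * (M * C₃) + 1) _ (fun i => sub_nonneg.mpr (hcbw i)) (fun i => ?_)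
  have := (abs_le.mp (hreg i)).2
  simp only [Pi.sub_apply, Pi.smul_apply, smul_eq_mul]
  push_cast at this ⊢
  nlinarith only [this]

omit [Fintype n] [DecidableEq n] in
/-- a coordinate is bounded by the `ℓ¹` norm. [folklore] -/
theorem abs_apply_le_l1 (v : Site (d + 1)) (i : Fin (d + 1)) : |v i| ≤ (l1 v : ℤ) := by
  rw [Int.abs_eq_natAbs]
  unfold l1
  exact_mod_cast Finset.single_le_sum (f := fun κ => (v κ).natAbs) (fun _ _ => Nat.zero_le _) (Finset.mem_univ i)

/-- **THE FINE BALL OF A NEARBY BLOCK IS IN THE WORKING REGION** (`L ≥ 2`, `M = L^{k+1}`, `nb = nbRad`): if `|M bc − y₀|_∞ ≤ MK_b + 2M` then on the ball `|x′ − M•bc|₁ ≤ nb·Σ_{i<k+1}L^i`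
the comb gauge is `(d+1)(2MC₃)x`-flat. [folklore] -/
theorem ball_near_flat [Nonempty n] {L : ℕ} (hL : 2 ≤ L) (k : ℕ) {W : Site (d + 1) → Fin (d + 1) → (Matrix n n ℂ)ˣ} {x : ℝ} (hWu : IsUnitaryCfg W) (hx : 0 ≤ x)
    (hWx : SmallField W x) (y₀ : Site (d + 1)) (Kb C₃ : ℕ) (hC₃ : C₃ = Kb + nbRad (d + 1) L + 3) (bc : Site (d + 1))
    (hbc : ∀ i, |((L ^ (k + 1) : ℕ) : ℤ) * bc i - y₀ i| ≤ ((L ^ (k + 1) : ℕ) : ℤ) * Kb + 2 * ((L ^ (k + 1) : ℕ) : ℤ))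
    (x' : Site (d + 1)) (hx' : l1 (x' - ((L : ℤ) ^ (k + 1)) • bc) ≤ nbRad (d + 1) L * ∑ i ∈ Finset.range (k + 1), L ^ i) (μ : Fin (d + 1)) :
    ‖((gaugeAct (btree (L ^ (k + 1)) W (fun i => blk (L ^ (k + 1)) y₀ i - (C₃ : ℤ))) W x' μ : (Matrix n n ℂ)ˣ) : Matrix n n ℂ) - 1‖
      ≤ (((d + 1 : ℕ) : ℝ) * ((((2 * (L ^ (k + 1) * C₃) + 1 : ℕ) : ℝ)) - 1)) * x := by
  have hL1 : 1 ≤ L := by omega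
  have hM1 : 1 ≤ L ^ (k + 1) := Nat.one_le_pow _ _ hL1
  have hMz : ((L ^ (k + 1) : ℕ) : ℤ) = (L : ℤ) ^ (k + 1) := by push_cast; ring
  have hMz1 : (1 : ℤ) ≤ ((L ^ (k + 1) : ℕ) : ℤ) := by exact_mod_cast hM1
  refine comb_near_flat hM1 hWu hx hWx y₀ Kb (nbRad (d + 1) L) C₃ hC₃ x'
    (((L ^ (k + 1) : ℕ) : ℤ) * (nbRad (d + 1) L) + 2 * ((L ^ (k + 1) : ℕ) : ℤ)) (fun i => ?_) (by linarith only [hMz1]) μ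
  have h1 : |(x' - ((L : ℤ) ^ (k + 1)) • bc) i| ≤ ((L ^ (k + 1) : ℕ) : ℤ) * (nbRad (d + 1) L) := by
    refine (abs_apply_le_l1 _ i).trans ?_
    have h2 : (l1 (x' - ((L : ℤ) ^ (k + 1)) • bc) : ℤ) ≤ ((nbRad (d + 1) L * ∑ i ∈ Finset.range (k + 1), L ^ i : ℕ) : ℤ) := by exact_mod_cast hx'
    have h3 : nbRad (d + 1) L * ∑ i ∈ Finset.range (k + 1), L ^ i ≤ nbRad (d + 1) L * L ^ (k + 1) := Nat.mul_le_mul_left _ (sum_pow_le_pow hL (k + 1))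
    have h4 : ((nbRad (d + 1) L * ∑ i ∈ Finset.range (k + 1), L ^ i : ℕ) : ℤ) ≤ ((nbRad (d + 1) L * L ^ (k + 1) : ℕ) : ℤ) := by exact_mod_cast h3
    refine h2.trans (h4.trans (le_of_eq ?_))
    push_cast; ring
  have h1' := abs_le.mp h1
  have hbc' := abs_le.mp (hbc i)
  simp only [Pi.sub_apply, Pi.smul_apply, smul_eq_mul, ← hMz] at h1'
  rw [abs_le]
  constructor <;> linarith only [h1'.1, h1'.2, hbc'.1, hbc'.2]

/-! ## §2 The curl datum -/

/-- **THE CURL DATUM**: with `W` unitary, `u` unitary, `‖curlAt W Y‖ ≤ B` off the diagonal (`B ≥ 0`), `‖Y^u‖ ≤ S`, `|χ| ≤ 1`, `χ` `g₁`-Lipschitz per sup-step, and `‖W^u(w,·) − 1‖ ≤ δ` (`δ ≥ 0`)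
at every `w` within sup-distance `1` of a point where `χ ≠ 0`: `‖curlAt 1 (χ•Y^u) z μ ν‖ ≤ B + 16δS + 2g₁S` for all `z` and `μ ≠ ν`. [folklore] -/
theorem curl_datum [Nonempty n] {W : Site (d + 1) → Fin (d + 1) → (Matrix n n ℂ)ˣ} (hWu : IsUnitaryCfg W) {u : Site (d + 1) → (Matrix n n ℂ)ˣ}
    (huu : ∀ y, u y ∈ unitaryUnits (Matrix n n ℂ)) (Y : Site (d + 1) → Fin (d + 1) → Matrix n n ℂ) (χ : Site (d + 1) → ℝ) {B S δ g₁ : ℝ} (hB0 : 0 ≤ B)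
    (hS0 : 0 ≤ S) (hδ0 : 0 ≤ δ) (hB : ∀ (z : Site (d + 1)) (μ ν : Fin (d + 1)), μ ≠ ν → ‖curlAt W Y z μ ν‖ ≤ B)
    (hS' : ∀ w μ, ‖dirGauge u Y w μ‖ ≤ S) (hχ1 : ∀ w, |χ w| ≤ 1) (hstep : ∀ x₁ x₂ : Site (d + 1), (∀ j, |x₂ j - x₁ j| ≤ 1) → |χ x₂ - χ x₁| ≤ g₁)
    (hnear : ∀ z : Site (d + 1), χ z ≠ 0 → ∀ w : Site (d + 1), (∀ i, |w i - z i| ≤ 1) → ∀ ν, ‖((gaugeAct u W w ν : (Matrix n n ℂ)ˣ) : Matrix n n ℂ) - 1‖ ≤ δ)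
    (z : Site (d + 1)) (μ ν : Fin (d + 1)) (hne : μ ≠ ν) :
    ‖curlAt (flat (d := d + 1) (n := n)) (fun w κ => χ w • dirGauge u Y w κ) z μ ν‖ ≤ B + 16 * δ * S + 2 * g₁ * S := by
  have hW'u : IsUnitaryCfg (gaugeAct u W) := isUnitaryCfg_gaugeAct' huu hWu
  have hst : ∀ μ' : Fin (d + 1), |χ (z + e μ') - χ z| ≤ g₁ := fun μ' =>
    hstep z (z + e μ') (fun j => by simp only [Pi.add_apply, e_apply]; split_ifs <;> simp)
  have hcomm := norm_curlAt_smul_fun_sub_le isUnitaryCfg_flat χ (dirGauge u Y) z μ ν (hst μ) (hst ν) (hS' _ _) (hS' _ _)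
  have hmainz : ‖χ z • curlAt (flat (d := d + 1) (n := n)) (dirGauge u Y) z μ ν‖ ≤ B + 16 * δ * S := by
    rw [norm_smul, Real.norm_eq_abs]
    have h0 : 0 ≤ B + 16 * δ * S := by nlinarith only [hB0, hδ0, hS0]
    by_cases hχz : χ z = 0
    · rw [hχz, abs_zero, zero_mul]; exact h0
    have hnr := hnear z hχz
    have hz0 : ∀ i, |z i - z i| ≤ 1 := fun i => by simp
    have hzμ : ∀ i, |(z + e μ) i - z i| ≤ 1 := fun i => by simp only [Pi.add_apply, e_apply]; split_ifs <;> simp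
    have hzν : ∀ i, |(z + e ν) i - z i| ≤ 1 := fun i => by simp only [Pi.add_apply, e_apply]; split_ifs <;> simp
    have hcf := norm_curlAt_sub_flat_le hW'u (dirGauge u Y) z μ ν hδ0 (hnr z hz0 μ) (hnr _ hzμ ν) (hnr _ hzν μ) (hS' _ _) (hS' _ _) (hS' _ _) (hS' _ _)
    have hcov : ‖curlAt (gaugeAct u W) (dirGauge u Y) z μ ν‖ ≤ B := by
      rw [curlAt_gaugeAct, norm_Ad_of_unitary (huu z)]; exact hB z μ ν hne
    have hfl : ‖curlAt (flat (d := d + 1) (n := n)) (dirGauge u Y) z μ ν‖ ≤ B + 16 * δ * S := by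
      have e1 : curlAt (flat (d := d + 1) (n := n)) (dirGauge u Y) z μ ν
          = curlAt (gaugeAct u W) (dirGauge u Y) z μ ν - (curlAt (gaugeAct u W) (dirGauge u Y) z μ ν - curlAt (flat (d := d + 1) (n := n)) (dirGauge u Y) z μ ν) := by abel
      rw [e1]; exact (norm_sub_le _ _).trans (add_le_add hcov hcf)
    have hn0 : 0 ≤ ‖curlAt (flat (d := d + 1) (n := n)) (dirGauge u Y) z μ ν‖ := norm_nonneg _
    calc |χ z| * ‖curlAt (flat (d := d + 1) (n := n)) (dirGauge u Y) z μ ν‖ ≤ 1 * ‖curlAt (flat (d := d + 1) (n := n)) (dirGauge u Y) z μ ν‖ :=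
          mul_le_mul_of_nonneg_right (hχ1 z) hn0
      _ ≤ B + 16 * δ * S := by rw [one_mul]; exact hfl
  have e2 : curlAt (flat (d := d + 1) (n := n)) (fun w κ => χ w • dirGauge u Y w κ) z μ ν
      = (curlAt (flat (d := d + 1) (n := n)) (fun w κ => χ w • dirGauge u Y w κ) z μ ν - χ z • curlAt (flat (d := d + 1) (n := n)) (dirGauge u Y) z μ ν)
        + χ z • curlAt (flat (d := d + 1) (n := n)) (dirGauge u Y) z μ ν := by rw [sub_add_cancel]
  rw [e2]
  refine (norm_add_le _ _).trans ((add_le_add hcomm hmainz).trans (le_of_eq ?_))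
  ring

/-! ## §3 The divergence datum, uniform -/

/-- **THE DIVERGENCE DATUM, UNIFORMLY IN THE POINT** (`NE7CurvedSupLetterDiv.div_datum` with `|χ| ≤ 1`). [folklore] -/
theorem div_datum_uniform [Nonempty n] (hd : 1 ≤ d) {L : ℕ} (hL : 2 ≤ L) (k : ℕ) {W : Site d → Fin d → (Matrix n n ℂ)ˣ} {x : ℝ}
    (hWu : IsUnitaryCfg W) (hx : 0 ≤ x) (hs : LevelSmall d L k x) (hWx : SmallField W x)
    {u : Site d → (Matrix n n ℂ)ˣ} (hu : ∀ y, u y ∈ unitaryUnits (Matrix n n ℂ))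
    (Y : Site d → Fin d → Matrix n n ℂ) {g : Site d → Matrix n n ℂ} (hloc : ∀ y, covDiv W Y y = nestedExt L (k + 1) W g y)
    {S G g₁ δ : ℝ} (hS : ∀ y μ, ‖Y y μ‖ ≤ S) (hG : ∀ b, ‖g b‖ ≤ G) (hGc : ∀ y, ‖covDiv W Y y‖ ≤ G) (hg₁ : 0 ≤ g₁) (hδ0 : 0 ≤ δ)
    (χ : Site d → ℝ) (hχ1 : ∀ w, |χ w| ≤ 1) (hstep : ∀ x₁ x₂ : Site d, (∀ j, |x₂ j - x₁ j| ≤ 1) → |χ x₂ - χ x₁| ≤ g₁)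
    {σ : ℝ} (hσdef : σ = ∑ i ∈ Finset.range (k + 1), ((L : ℝ) ^ i * δ + 2 * loopRad d L ((prop1Radius d L)^[i] x)))
    (hσ : 2 * ((d : ℝ) * ((L : ℝ) - 1)) * σ ≤ 1 / 2)
    (hWq : ∀ xp : Site d, χ xp ≠ 0 → ∀ μ, ‖((gaugeAct u W xp μ : (Matrix n n ℂ)ˣ) : Matrix n n ℂ) - 1‖ ≤ δ)
    (hball : ∀ xp : Site d, χ xp ≠ 0 → ∀ (x' : Site d) (μ : Fin d), l1 (x' - ((L : ℤ) ^ (k + 1)) • blk (L ^ (k + 1)) xp) ≤ nbRad d L * ∑ i ∈ Finset.range (k + 1), L ^ i →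
      ‖((gaugeAct u W x' μ : (Matrix n n ℂ)ˣ) : Matrix n n ℂ) - 1‖ ≤ δ)
    (xp : Site d) :
    ‖flatDiv (fun y μ => χ y • dirGauge u Y y μ) xp
        - (fun b : Site d => χ (((L ^ (k + 1) : ℕ) : ℤ) • b) • Ad (u (((L ^ (k + 1) : ℕ) : ℤ) • b)) (covDiv W Y (((L ^ (k + 1) : ℕ) : ℤ) • b))) (blk (L ^ (k + 1)) xp)‖
      ≤ d * g₁ * S + (d * (2 * δ * S) + 4 * ((d : ℝ) * ((L : ℝ) - 1)) * σ * G) + (((L ^ (k + 1) - 1 : ℕ)) : ℝ) * g₁ * G := by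
  have h := div_datum hd hL k hWu hx hs hWx hu Y hloc hS hG hGc hg₁ hδ0 χ hstep (by rw [← hσdef]; exact hσ) xp (hWq xp) (hball xp)
  rw [← hσdef] at h
  refine h.trans ?_
  have hS0 : 0 ≤ S := (norm_nonneg _).trans (hS 0 ⟨0, by omega⟩)
  have hG0 : 0 ≤ G := (norm_nonneg _).trans (hG 0)
  have hL1 : (1 : ℝ) ≤ L := by exact_mod_cast (show 1 ≤ L by omega)
  have hσ0 : 0 ≤ σ := by
    rw [hσdef]; exact Finset.sum_nonneg fun i _ => by
      have hr := NE3CovariantLineSumsError.iterate_prop1Radius_nonneg (d := d) (L := L) i hx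
      have hl : 0 ≤ loopRad d L ((prop1Radius d L)^[i] x) := by unfold loopRad; positivity
      have hp : (0 : ℝ) ≤ (L : ℝ) ^ i := by positivity
      nlinarith only [hl, hp, hδ0]
  have hin : 0 ≤ d * (2 * δ * S) + 4 * ((d : ℝ) * ((L : ℝ) - 1)) * σ * G := by
    have t1 : 0 ≤ (d : ℝ) * (2 * δ * S) := mul_nonneg (Nat.cast_nonneg d) (by nlinarith only [hδ0, hS0])
    have t2 : 0 ≤ 4 * ((d : ℝ) * ((L : ℝ) - 1)) * σ * G :=
      mul_nonneg (mul_nonneg (mul_nonneg (by norm_num) (mul_nonneg (Nat.cast_nonneg d) (by linarith only [hL1]))) hσ0) hG0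
    linarith only [t1, t2]
  have ha := hχ1 xp
  nlinarith only [ha, hin, abs_nonneg (χ xp)]

/-! ## §4 The straight datum, uniform -/

/-- **THE STRAIGHT DATUM, UNIFORMLY IN THE BLOCK** (class at `W`, `L ≥ 2`, unitary `u`, `QbarIter L (k+1) W Y = 0`, `‖Y‖ ≤ S`, `|χ| ≤ 1`, `χ` `g₁`-Lipschitz per sup-step; `M = L^{k+1}`): if the
comb gauge is `δ`-flat on the fine ball of every block `zc` whose straight-average region meets the support of `χ`, then for every `zc, κ`
`‖QbarIter L (k+1) flat (χ•Y^u) zc κ‖ ≤ M·(2(M−1)·g₁·S) + 2L^k S·[(2d+4)L²·Mδ + (2(2d+4)L² + 8L + C_sup)·(4∕3)·17(d+1)(d+4)·M²x]`. [folklore] -/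
theorem straight_datum_uniform [Nonempty n] {L : ℕ} (hL : 2 ≤ L) (k : ℕ) {W : Site d → Fin d → (Matrix n n ℂ)ˣ} {x : ℝ}
    (hWu : IsUnitaryCfg W) (hx : 0 ≤ x) (hs : LevelSmall d L k x) (hWx : SmallField W x)
    {u : Site d → (Matrix n n ℂ)ˣ} (hu : ∀ y, u y ∈ unitaryUnits (Matrix n n ℂ)) (Y : Site d → Fin d → Matrix n n ℂ) (χ : Site d → ℝ)
    (hY0 : QbarIter L (k + 1) W Y = 0) {S g₁ δ : ℝ} (hS0 : 0 ≤ S) (hS : ∀ y μ, ‖Y y μ‖ ≤ S)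
    (hχ1 : ∀ y, |χ y| ≤ 1) (hstep : ∀ x₁ x₂ : Site d, (∀ j, |x₂ j - x₁ j| ≤ 1) → |χ x₂ - χ x₁| ≤ g₁) (hg₁ : 0 ≤ g₁) (hδ0 : 0 ≤ δ)
    (hballχ : ∀ (zc : Site d) (κ : Fin d), (∃ x' : Site d, (((L ^ (k + 1) : ℕ) : ℤ) • zc) ≤ x' ∧ (∀ i, i ≠ κ → x' i ≤ ((((L ^ (k + 1) : ℕ) : ℤ) • zc) i) + (((L ^ (k + 1) : ℕ) : ℤ) - 1)) ∧
        x' κ ≤ ((((L ^ (k + 1) : ℕ) : ℤ) • zc) κ) + 2 * (((L ^ (k + 1) : ℕ) : ℤ) - 1) ∧ χ x' ≠ 0) →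
      ∀ (x' : Site d) (μ : Fin d), l1 (x' - ((L : ℤ) ^ (k + 1)) • zc) ≤ nbRad d L * ∑ i ∈ Finset.range (k + 1), L ^ i →
        ‖((gaugeAct u W x' μ : (Matrix n n ℂ)ˣ) : Matrix n n ℂ) - 1‖ ≤ δ)
    (zc : Site d) (κ : Fin d) :
    ‖QbarIter L (k + 1) (flat (d := d) (n := n)) (fun y μ => χ y • dirGauge u Y y μ) zc κ‖
      ≤ ((L ^ (k + 1) : ℕ) : ℝ) * ((((2 * (L ^ (k + 1) - 1) : ℕ)) : ℝ) * g₁ * S)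
        + (L : ℝ) ^ k * (2 * S) * ((2 * (d : ℝ) + 4) * (L : ℝ) ^ 2 * ((L : ℝ) ^ (k + 1) * δ)
          + (2 * ((2 * (d : ℝ) + 4) * (L : ℝ) ^ 2) + (8 * (L : ℝ) + Csup d L)) * (4 / 3 * (17 * (((d : ℝ) + 1) * ((d : ℝ) + 4)) * (((L : ℝ) ^ (k + 1)) ^ 2 * x)))) := by
  have hdir : (fun y μ => χ y • dirGauge u Y y μ) = fun y μ => χ y • Ad (u (y + e μ)) (Y y μ) := rfl
  rw [hdir]
  have hrhs0 : 0 ≤ ((L ^ (k + 1) : ℕ) : ℝ) * ((((2 * (L ^ (k + 1) - 1) : ℕ)) : ℝ) * g₁ * S)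
      + (L : ℝ) ^ k * (2 * S) * ((2 * (d : ℝ) + 4) * (L : ℝ) ^ 2 * ((L : ℝ) ^ (k + 1) * δ)
        + (2 * ((2 * (d : ℝ) + 4) * (L : ℝ) ^ 2) + (8 * (L : ℝ) + Csup d L)) * (4 / 3 * (17 * (((d : ℝ) + 1) * ((d : ℝ) + 4)) * (((L : ℝ) ^ (k + 1)) ^ 2 * x)))) := by
    have := NE3CovariantLineSumsError.Csup_nonneg d L
    positivity
  by_cases hfar : ∀ x' : Site d, (((L ^ (k + 1) : ℕ) : ℤ) • zc) ≤ x' → (∀ i, i ≠ κ → x' i ≤ ((((L ^ (k + 1) : ℕ) : ℤ) • zc) i) + (((L ^ (k + 1) : ℕ) : ℤ) - 1)) →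
      x' κ ≤ ((((L ^ (k + 1) : ℕ) : ℤ) • zc) κ) + 2 * (((L ^ (k + 1) : ℕ) : ℤ) - 1) → χ x' = 0
  · -- off the support: the datum vanishes
    have hS' : ∀ y μ, ‖Ad (u (y + e μ)) (Y y μ)‖ ≤ S := fun y μ => norm_dirGauge_le hu Y hS y μ
    rw [straight_datum_off_support hL k (fun y μ => Ad (u (y + e μ)) (Y y μ)) χ zc κ hS' hfar, norm_zero]
    exact hrhs0
  · push Not at hfar
    obtain ⟨x', h1, h2, h3, h4⟩ := hfar
    exact straight_datum_closed hL k hWu hx hs hWx hu Y χ zc κ (congrFun (congrFun hY0 zc) κ) hS0 hS hχ1 hstep hδ0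
      (hballχ zc κ ⟨x', h1, h2, h3, h4⟩)

/-! ## §5 The support of the cut-off field -/

omit [Fintype n] [DecidableEq n] in
/-- **THE CUT-OFF FIELD VANISHES OFF THE `4M`-INTERIOR OF THE CUBE** `M•c′ + [0, M·N′)^{d+1}` with `c′ = blk_M y₀ − (K_b + 6)·𝟙`, `N′ = 2K_b + 12` (`χ = chi 0 (MK_b) y₀`, `M ≥ 1`, `K_b ≥ 1`).
[folklore] -/
theorem support_of_cutoff {M Kb : ℕ} (hM1 : 1 ≤ M) (hKb : 1 ≤ Kb) (y₀ : Site (d + 1)) (F : Site (d + 1) → Fin (d + 1) → Matrix n n ℂ)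
    (xp : Site (d + 1))
    (hx : ∃ i, ¬ ((M : ℤ) * (blk M y₀ i - ((Kb + 6 : ℕ) : ℤ)) + 4 * (M : ℤ) ≤ xp i ∧ xp i < (M : ℤ) * (blk M y₀ i - ((Kb + 6 : ℕ) : ℤ)) + (M : ℤ) * ((2 * Kb + 12 : ℕ) : ℤ) - 4 * (M : ℤ))) :
    (fun μ => chi 0 (M * Kb) y₀ xp • F xp μ) = 0 := by
  have hMKb : 1 ≤ M * Kb := Nat.mul_pos (by omega) (by omega)
  have hχ0 : chi 0 (M * Kb) y₀ xp = 0 := by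
    refine chi_eq_zero_of_not_mem hMKb (fun hmem => ?_)
    rw [zero_add] at hmem
    obtain ⟨i, hi⟩ := hx
    apply hi
    have h := abs_le.mp ((mem_box_iff.mp hmem) i)
    have hb := congr_fun (blk_add_res M y₀) i
    simp only [Pi.add_apply, Pi.smul_apply, smul_eq_mul] at hb
    have h0 := res_nonneg hM1 y₀ i
    have h1 := res_le hM1 y₀ i
    have hMz1 : (1 : ℤ) ≤ (M : ℤ) := by exact_mod_cast hM1
    push_cast at h ⊢
    constructor <;> nlinarith only [h.1, h.2, hb, h0, h1, hMz1, (Nat.cast_nonneg Kb : (0:ℤ) ≤ Kb)]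
  funext μ
  rw [hχ0, zero_smul, Pi.zero_apply]

end

end Summit.QuantumFields.BalabanUV.T4Continuum.NE7CurvedSupLetterData
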